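import Summits.PneNP.PneNP.Theorems.SmallBlockRothvossBallGridCore
import Summits.PneNP.PneNP.Theorems.SmallBlockRothvossFace
import Literature.Barriers.PneNP.TSPExtensionComplexityRothvossAssembly
import Literature.Combinatorics.Optimization.BlockPsdFactorization
import Mathlib.Analysis.Complex.ExponentialBounds
import HarnessLib

/-!
# Block psd lifts of the perfect matching polytope: the polynomial-in-`b` block bound (cell pnp-psdrank, rung F-N2.SOC)

Landing file 3 of 3 after files 1a/1b/2 (pnp-psdrank-eng g4; work file HOME/pnp-psdrank-eng/lean/BlockLift.lean v2, sha256/16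
01d03dbb37281499, Part D). Main results, over the tree vocabulary
`Literature.Combinatorics.Optimization.HasBlockPsdFactorization` (an `(S^b_+)^m`-factorization of the odd-cut
slack matrix of the perfect matching polytope `P_PM(n)`, i.e. an `(S^b_+)^m`-lift):

* `block_core`: at Rothvoß's slot sizes every `r`-term `(S^b_+)` factorization of the `t`-cut slack matrix has
  `2^{δ_R m/(b+1)} ≤ r · 14400 b⁵ · (t−1)³` — polynomial in `b`, no factor `c^b`;
* `blockPsd_explicit`: for all even `n ≥ n₀`, all `b ≥ 1`, all `m`:
  `HasBlockPsdFactorization n b m → 2^{δ_R n/(798(b+1))} ≤ m · 14400 b⁵ n³`;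
* `blockPsd_largeBlocks`: `∃ c > 0, ∀ even n ≥ n₀, ∀ 1 ≤ b ≤ n, ∀ m: HasBlockPsdFactorization n b m →
  2^{c·n/(b+1)} ≤ m · n⁹` — an SDP lift of `P_PM(n)` with polynomially many blocks must contain a block of
  dimension `Ω(n/log n)`; blocks of dimension `≤ n^{1−ε}` force `2^{Ω(n^ε)}` blocks.

This interpolates Rothvoß's LP theorem (`b = 1`, tree `Rothvoss2017_tsp_holds` chain), the cell's T-SOC
(`b = 2`, `SmallBlockRothvoss*`) and the fixed-`b` leaf `Summit.PneNP.MatchingPsdRank.MatchingBlockPsdBound`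
(closed by the `SmallBlockRothvossGrid*` chain; it also follows from `blockPsd_explicit` with
`α_b = δ_R/(1596(b+1))`, not restated here). Mechanism (`caseA_arith`): with `λ = 2^{δ_R m/(2b+2)}` and
`2L+1` the least odd integer `≥ λ` (when `λ ≥ 4b`), the `(2L+1)^{2b}` cell pairs cost
`((2L+1)/λ)^{2b}·2θ_R λ^{2b} ≤ 2e^{4b/λ}/λ² ≤ 6/λ²` and the garbage term `448 bΔ²/L² ≤ 7168 bΔ²/λ²`.
[cite: Rothvoss2017, Thm. 1 / Lemma 6] [cite: FawziParrilo2013, Thm. 1 (the COR analogue, `c(b)^n`)]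
WHAT THIS IS NOT: not a bound on general psd rank / SDP extension complexity of matching (one block of dimension
`≥ n/log n` escapes; rung F-N2 `TracialDecayExp20` stays open); nothing here is P ≠ NP-relevant; constants
(`δ_R`, `798`, `14400`) are the tree's qualitative Rothvoß constants, not optimised.
-/

set_option linter.dupNamespace false -- `Summit.PneNP.PneNP.…`: summit = sub-problem (D-0017)

noncomputable section

open scoped Classical MatrixOrder

open Finset Real Matrix Literature.Barriers.PneNP Literature.Combinatorics.Optimization

namespace Summit.PneNP.PneNP.Theorems.SmallBlockRothvossBallGrid

/-- `16 b² ≤ 14400 b⁵ Δ³` for `b, Δ ≥ 1` (Case B bookkeeping). -/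
theorem sq_le_Cb {b : ℕ} (hb : 1 ≤ b) {Δ : ℝ} (hΔ : 1 ≤ Δ) : 16 * (b : ℝ) ^ 2 ≤ 14400 * (b : ℝ) ^ 5 * Δ ^ 3 := by
  have hb1 : (1 : ℝ) ≤ b := by exact_mod_cast hb
  have hb3 : (1 : ℝ) ≤ (b : ℝ) ^ 3 := one_le_pow₀ hb1
  have hΔ3 : (1 : ℝ) ≤ Δ ^ 3 := one_le_pow₀ hΔ
  have hb2 : (0 : ℝ) ≤ (b : ℝ) ^ 2 := sq_nonneg _
  have h1 : (1 : ℝ) ≤ (b : ℝ) ^ 3 * Δ ^ 3 := by nlinarith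
  calc 16 * (b : ℝ) ^ 2 = 16 * (b : ℝ) ^ 2 * 1 := (mul_one _).symm
    _ ≤ 16 * (b : ℝ) ^ 2 * ((b : ℝ) ^ 3 * Δ ^ 3) := mul_le_mul_of_nonneg_left h1 (by positivity)
    _ ≤ 14400 * (b : ℝ) ^ 2 * ((b : ℝ) ^ 3 * Δ ^ 3) := by nlinarith [mul_nonneg hb2 (le_trans zero_le_one h1)]
    _ = 14400 * (b : ℝ) ^ 5 * Δ ^ 3 := by ring

/-- `(1 + x)^k ≤ 3` when `k x ≤ 1`, `x ≥ 0` (via `1 + x ≤ exp x` and `exp 1 < 3`). -/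
theorem one_add_pow_le_three {x : ℝ} {k : ℕ} (hx : 0 ≤ x) (hkx : (k : ℝ) * x ≤ 1) :
    (1 + x) ^ k ≤ 3 := by
  have h1 : 1 + x ≤ Real.exp x := by have := Real.add_one_le_exp x; linarith
  have h2 : (1 + x) ^ k ≤ (Real.exp x) ^ k := pow_le_pow_left₀ (by linarith) h1 k
  rw [← Real.exp_nat_mul] at h2
  have h3 : Real.exp ((k : ℝ) * x) ≤ Real.exp 1 := Real.exp_le_exp.2 hkx
  have h4 := Real.exp_one_lt_d9
  linarith

/-- Arithmetic of Case A of `block_core` (`4b ≤ λ`, grid resolution `L` with `2L+1` the least odd integer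
`≥ λ`): the `core_at` inequality forces `λ² ≤ 14400 · r b⁵ Δ³`. -/
theorem caseA_arith (b : ℕ) {r Δ lam L θ : ℝ} (hb1 : 1 ≤ (b : ℝ)) (hΔ2 : 2 ≤ Δ) (hr0 : 0 ≤ r)
    (hlam0 : 0 < lam) (hcase : 4 * (b : ℝ) ≤ lam) (hLge : (lam - 1) / 2 ≤ L) (hLlt : L < (lam - 1) / 2 + 1)
    (hθ0 : 0 < θ) (hθlam : θ * lam ^ (2 * b + 2) = 1)
    (key : (1 : ℝ) / 2 ≤ (b : ℝ) ^ 4 * Δ * r *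
      (((2 * L + 1) ^ b) ^ 2 * (2 * θ) + 448 * b * Δ ^ 2 / L ^ 2)) :
    lam ^ 2 ≤ r * (14400 * (b : ℝ) ^ 5 * Δ ^ 3) := by
  have hL2 : lam ≤ 2 * L + 1 := by linarith
  have hL3 : 2 * L + 1 < lam + 2 := by linarith
  have hL0 : 0 < L := by linarith
  have hlam2 : 0 < lam ^ 2 := by positivity
  -- `(2L+1)^{2b} ≤ 3 λ^{2b}`: `2L+1 ≤ λ(1 + 2/λ)` and `(1 + 2/λ)^{2b} ≤ exp(4b/λ) ≤ e < 3`
  have hx0 : (0 : ℝ) ≤ 2 / lam := by positivity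
  have hkx : ((2 * b : ℕ) : ℝ) * (2 / lam) ≤ 1 := by
    push_cast
    rw [show (2 : ℝ) * b * (2 / lam) = 4 * b / lam by ring, div_le_one hlam0]
    exact hcase
  have h3 : (1 + 2 / lam) ^ (2 * b) ≤ 3 := one_add_pow_le_three hx0 hkx
  have hL5 : 2 * L + 1 ≤ lam * (1 + 2 / lam) := by
    rw [mul_add, mul_div_cancel₀ _ hlam0.ne', mul_one]; linarith
  have hpow : ((2 * L + 1) ^ b) ^ 2 ≤ 3 * lam ^ (2 * b) := by
    have h1 : (2 * L + 1) ^ b ≤ (lam * (1 + 2 / lam)) ^ b := pow_le_pow_left₀ (by positivity) hL5 b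
    have h2 : ((2 * L + 1) ^ b) ^ 2 ≤ ((lam * (1 + 2 / lam)) ^ b) ^ 2 :=
      pow_le_pow_left₀ (by positivity) h1 2
    have h4 : ((lam * (1 + 2 / lam)) ^ b) ^ 2 = lam ^ (2 * b) * (1 + 2 / lam) ^ (2 * b) := by
      rw [← pow_mul, mul_pow, mul_comm b 2]
    rw [h4] at h2
    have h5 : lam ^ (2 * b) * (1 + 2 / lam) ^ (2 * b) ≤ lam ^ (2 * b) * 3 :=
      mul_le_mul_of_nonneg_left h3 (by positivity)
    linarith
  have hθ2b : θ * lam ^ (2 * b) * lam ^ 2 = 1 := by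
    rw [mul_assoc, ← pow_add]; exact hθlam
  have hE : ((2 * L + 1) ^ b) ^ 2 * (2 * θ) ≤ 6 / lam ^ 2 := by
    rw [le_div_iff₀ hlam2]
    calc ((2 * L + 1) ^ b) ^ 2 * (2 * θ) * lam ^ 2
        ≤ (3 * lam ^ (2 * b)) * (2 * θ) * lam ^ 2 :=
          mul_le_mul_of_nonneg_right (mul_le_mul_of_nonneg_right hpow (by positivity)) hlam2.le
      _ = 6 * (θ * lam ^ (2 * b) * lam ^ 2) := by ring
      _ = 6 := by rw [hθ2b, mul_one]
  have hτ : 448 * b * Δ ^ 2 / L ^ 2 ≤ 7168 * b * Δ ^ 2 / lam ^ 2 := by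
    rw [div_le_div_iff₀ (by positivity) hlam2]
    have hL4 : lam ≤ 4 * L := by linarith
    have h1 : lam ^ 2 ≤ 16 * L ^ 2 := by nlinarith
    have h0 : (0 : ℝ) ≤ 448 * b * Δ ^ 2 := by positivity
    calc 448 * b * Δ ^ 2 * lam ^ 2 ≤ 448 * b * Δ ^ 2 * (16 * L ^ 2) :=
          mul_le_mul_of_nonneg_left h1 h0
      _ = 7168 * b * Δ ^ 2 * L ^ 2 := by ring
  have hsum_le : ((2 * L + 1) ^ b) ^ 2 * (2 * θ) + 448 * b * Δ ^ 2 / L ^ 2 ≤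
      (6 + 7168 * b * Δ ^ 2) / lam ^ 2 := by
    rw [add_div]; exact add_le_add hE hτ
  have hpre : (0 : ℝ) ≤ (b : ℝ) ^ 4 * Δ * r := by positivity
  have key2 : (1 : ℝ) / 2 ≤ (b : ℝ) ^ 4 * Δ * r * ((6 + 7168 * b * Δ ^ 2) / lam ^ 2) :=
    key.trans (mul_le_mul_of_nonneg_left hsum_le hpre)
  have key3 : lam ^ 2 ≤ 2 * ((b : ℝ) ^ 4 * Δ * r * (6 + 7168 * b * Δ ^ 2)) := by
    rw [← mul_div_assoc, le_div_iff₀ hlam2] at key2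
    linarith
  -- constants: `2 b⁴ Δ (6 + 7168 b Δ²) ≤ 14400 b⁵ Δ³`
  have hΔ1 : (1 : ℝ) ≤ Δ := by linarith
  have hb4 : (0 : ℝ) ≤ (b : ℝ) ^ 4 := by positivity
  have inner : 2 * ((b : ℝ) ^ 4 * Δ * (6 + 7168 * b * Δ ^ 2)) ≤ 14400 * (b : ℝ) ^ 5 * Δ ^ 3 := by
    have hΔΔ : Δ ≤ Δ ^ 3 := by nlinarith
    have t1 : (b : ℝ) ^ 4 * Δ ≤ (b : ℝ) ^ 5 * Δ ^ 3 := by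
      have e1 : (b : ℝ) ^ 4 ≤ (b : ℝ) ^ 5 := by
        calc (b : ℝ) ^ 4 = (b : ℝ) ^ 4 * 1 := (mul_one _).symm
          _ ≤ (b : ℝ) ^ 4 * b := mul_le_mul_of_nonneg_left hb1 hb4
          _ = (b : ℝ) ^ 5 := by ring
      exact mul_le_mul e1 hΔΔ (by linarith) (by positivity)
    have t2 : (b : ℝ) ^ 4 * Δ * (b * Δ ^ 2) = (b : ℝ) ^ 5 * Δ ^ 3 := by ring
    nlinarith [t1, t2]
  calc lam ^ 2 ≤ 2 * ((b : ℝ) ^ 4 * Δ * r * (6 + 7168 * b * Δ ^ 2)) := key3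
    _ = r * (2 * ((b : ℝ) ^ 4 * Δ * (6 + 7168 * b * Δ ^ 2))) := by ring
    _ ≤ r * (14400 * (b : ℝ) ^ 5 * Δ ^ 3) := mul_le_mul_of_nonneg_left inner hr0

/-- Arithmetic of Case B of `block_core` (`λ < 4b`): the claim is below the trivial bound `r ≥ 1`. -/
theorem caseB_arith (b : ℕ) {r Δ lam : ℝ} (hb : 1 ≤ b) (hΔ2 : 2 ≤ Δ) (hr1 : 1 ≤ r) (hlam0 : 0 < lam)
    (hcase : lam < 4 * (b : ℝ)) : lam ^ 2 ≤ r * (14400 * (b : ℝ) ^ 5 * Δ ^ 3) := by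
  have hΔ1 : (1 : ℝ) ≤ Δ := by linarith
  have hlamb : lam ^ 2 ≤ 16 * (b : ℝ) ^ 2 := by nlinarith
  have hC : 0 ≤ 14400 * (b : ℝ) ^ 5 * Δ ^ 3 := by positivity
  calc lam ^ 2 ≤ 16 * (b : ℝ) ^ 2 := hlamb
    _ ≤ 14400 * (b : ℝ) ^ 5 * Δ ^ 3 := sq_le_Cb hb hΔ1
    _ = 1 * (14400 * (b : ℝ) ^ 5 * Δ ^ 3) := (one_mul _).symm
    _ ≤ r * (14400 * (b : ℝ) ^ 5 * Δ ^ 3) := mul_le_mul_of_nonneg_right hr1 hC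

/-- **The `b × b`-block bound at Rothvoß's slot sizes (explicit, polynomial in `b`).** For `m = 2μ+1`
large and `n = |Slot m 72|`: if the `t`-cut slack matrix `|δ(U) ∩ M| − 1` of `P_PM(n)` (`t = tCut 72 μ`) is a
sum of `r` pairings of psd `b × b` blocks (`b ≥ 1`), then `2^{δ_R m/(b+1)} ≤ r · 14400 b⁵ · (t − 1)³`.
Proof: with `λ = 2^{δ_R m/(2(b+1))}`, if `λ ≥ 4b` run `core_at` at the grid resolution `L` for which `2L+1` is
the least odd integer `≥ λ` — then `((2L+1)/λ)^{2b} ≤ (1 + 2/λ)^{2b} ≤ 3` and `θ_R λ^{2b+2} = 1`, so the net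
term is `≤ 6/λ²` and the garbage term `≤ 7168 bΔ²/λ²`; if `λ < 4b` the claim is below the trivial bound
`r ≥ 1` (itself read off `core_at` at `L = b`). No factor exponential in `b` is lost. -/
theorem block_core (μ : ℕ) {m : ℕ} (hm : m = 2 * μ + 1)
    (hU1 : (64 / cU εR) ^ 2 ≤ (m : ℝ) + 1) (hU2 : 32 / cU εR ≤ (m : ℝ) + 1)
    (hM1 : 16 * FQ * Real.log QB / cM qR εR ≤ (m : ℝ)) {b r : ℕ} (hb : 1 ≤ b)
    (A : {U : Finset (Fin (Fintype.card (Slot m qR))) // U.card = tCut qR μ} →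
      Fin r → Matrix (Fin b) (Fin b) ℝ)
    (B : {M : Finset (Sym2 (Fin (Fintype.card (Slot m qR)))) // IsPMOn univ M} →
      Fin r → Matrix (Fin b) (Fin b) ℝ)
    (hA : ∀ a i, (A a i).PosSemidef) (hB : ∀ b i, (B b i).PosSemidef)
    (hfac : ∀ (a : {U : Finset (Fin (Fintype.card (Slot m qR))) // U.card = tCut qR μ})
      (c : {M : Finset (Sym2 (Fin (Fintype.card (Slot m qR)))) // IsPMOn univ M}),
      ((c.1.filter (fun f => cutCount a.1 f = 1)).card : ℝ) - 1 = ∑ i, (A a i * B c i).trace) :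
    (2 : ℝ) ^ (δR * m / (b + 1)) ≤ r * (14400 * (b : ℝ) ^ 5 * ((tCut qR μ : ℝ) - 1) ^ 3) := by
  have hδ := δR_pos
  have ht3 : 3 ≤ tCut qR μ := by unfold tCut; omega
  have hΔ2 : (2 : ℝ) ≤ (tCut qR μ : ℝ) - 1 := by
    have : (3 : ℝ) ≤ (tCut qR μ : ℝ) := by exact_mod_cast ht3
    linarith
  have hb1 : (1 : ℝ) ≤ b := by exact_mod_cast hb
  have hr0 : (0 : ℝ) ≤ r := Nat.cast_nonneg r
  -- `λ = 2^{δ m / (2(b+1))}`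
  set lam : ℝ := (2 : ℝ) ^ (δR * m / (2 * (b + 1))) with hlam
  have hlam0 : 0 < lam := Real.rpow_pos_of_pos (by norm_num) _
  have hlamsq : lam ^ 2 = (2 : ℝ) ^ (δR * m / (b + 1)) := by
    rw [hlam, ← Real.rpow_natCast, ← Real.rpow_mul (by norm_num)]
    congr 1
    push_cast
    field_simp
  have hθlam : θR m * lam ^ (2 * b + 2) = 1 := by
    rw [hlam, ← Real.rpow_natCast, ← Real.rpow_mul (by norm_num)]
    have : δR * m / (2 * (b + 1)) * ((2 * b + 2 : ℕ) : ℝ) = δR * m := by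
      push_cast
      field_simp
    rw [this]
    exact θR_mul_rpow m
  rw [← hlamsq]
  -- `r ≥ 1`, read off the grid at resolution `L = b`
  have key0 := core_at μ hm hU1 hU2 hM1 A B hA hB hfac b hb (Nat.le_self_pow two_ne_zero b)
  have hr1 : (1 : ℝ) ≤ r := by
    rcases Nat.eq_zero_or_pos r with hr | hr
    · exfalso
      rw [hr] at key0
      norm_num at key0
    · exact_mod_cast hr
  by_cases hcase : 4 * (b : ℝ) ≤ lam
  · -- Case A: the grid at resolution `L`, `2L + 1` the least odd integer `≥ λ`
    have hLge : (lam - 1) / 2 ≤ (⌈(lam - 1) / 2⌉₊ : ℝ) := Nat.le_ceil _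
    have hLlt : (⌈(lam - 1) / 2⌉₊ : ℝ) < (lam - 1) / 2 + 1 := Nat.ceil_lt_add_one (by linarith)
    have hLb : (b : ℝ) ≤ (⌈(lam - 1) / 2⌉₊ : ℝ) := by linarith
    have hLb' : b ≤ ⌈(lam - 1) / 2⌉₊ := by exact_mod_cast hLb
    have hLpos : 0 < ⌈(lam - 1) / 2⌉₊ := lt_of_lt_of_le hb hLb'
    have key := core_at μ hm hU1 hU2 hM1 A B hA hB hfac ⌈(lam - 1) / 2⌉₊ hLpos
      (hLb'.trans (Nat.le_self_pow two_ne_zero _))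
    exact caseA_arith b hb1 hΔ2 hr0 hlam0 hcase hLge hLlt (θR_pos m) hθlam key
  · -- Case B: `λ < 4b`
    push Not at hcase
    exact caseB_arith b hb hΔ2 hr1 hlam0 hcase

/-- **Face monotonicity** (same statement as the tree's `HasBlockPsdFactorization.of_le`, via the cell's face
construction `SmallBlockRothvoss.liftPM`): a block psd factorization for `K_n` restricts to one for `K_N`,
`N ≤ n`, `n − N` even. [cite: Rothvoss2017, §1 (faces of the matching polytope)] -/
theorem hasBlockPsdFactorization_restrict {N n b m : ℕ} (hNn : N ≤ n) (h : HasBlockPsdFactorization n b m)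
    (hev : Even (n - N)) : HasBlockPsdFactorization N b m := by
  obtain ⟨A, B, hA, hB, hS⟩ := h
  obtain ⟨M₀, hM₀⟩ :=
    exists_isPMOn_of_even (n - N) (SmallBlockRothvoss.rest hNn) (SmallBlockRothvoss.card_rest hNn) hev
  refine ⟨fun M' i => A (SmallBlockRothvoss.liftPM hNn M₀ M') i,
    fun U' i => B (U'.map (SmallBlockRothvoss.emb hNn)) i,
    fun M' i hM' => hA _ i (SmallBlockRothvoss.liftPM_isPMOn hNn hM₀ hM'),
    fun U' i hU' => hB _ i (by rwa [card_map]),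
    fun U' M' hU' hM' => ?_⟩
  have h1 := hS (U'.map (SmallBlockRothvoss.emb hNn)) (SmallBlockRothvoss.liftPM hNn M₀ M')
    (by rwa [card_map]) (SmallBlockRothvoss.liftPM_isPMOn hNn hM₀ hM')
  unfold pmSlack at h1 ⊢
  rw [SmallBlockRothvoss.card_cut_liftPM hNn hM₀] at h1
  exact h1

/-- **Explicit fixed-block bound for `P_PM(n)`.** There is `n₀` (Rothvoß's largeness thresholds) such that
for all even `n ≥ n₀`, all block sizes `b ≥ 1` and all `m`: every `(S^b_+)^m` factorization of the odd-cut
slack matrix of `P_PM(n)` has `2^{δ_R n/(798(b+1))} ≤ m · 14400 b⁵ · n³`. Proof: face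
`P_PM(N) ↪ P_PM(n)` at Rothvoß's slot size `N = 216m+150 ≤ n < N + 432` (`hasBlockPsdFactorization_restrict`)
and `block_core`. -/
theorem blockPsd_explicit : ∃ n₀ : ℕ, ∀ n : ℕ, n₀ ≤ n → Even n → ∀ b m : ℕ, 1 ≤ b →
    HasBlockPsdFactorization n b m →
      (2 : ℝ) ^ (δR * n / (798 * (b + 1))) ≤ m * (14400 * (b : ℝ) ^ 5 * (n : ℝ) ^ 3) := by
  have hδ := δR_pos
  set T : ℝ := max (798 * ((64 / cU εR) ^ 2)) (max (798 * (32 / cU εR))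
    (798 * (16 * FQ * Real.log QB / cM qR εR))) with hT
  refine ⟨max 1000 ⌈T⌉₊, fun n hn heven b r hb hfac => ?_⟩
  have hn1000 : 1000 ≤ n := le_trans (le_max_left _ _) hn
  have hnT : T ≤ (n : ℝ) := (Nat.le_ceil T).trans (by exact_mod_cast le_trans (le_max_right _ _) hn)
  have hT1 : 798 * ((64 / cU εR) ^ 2) ≤ (n : ℝ) := le_trans (le_max_left _ _) hnT
  have hT2 : 798 * (32 / cU εR) ≤ (n : ℝ) := le_trans (le_trans (le_max_left _ _) (le_max_right _ _)) hnT
  have hT3 : 798 * (16 * FQ * Real.log QB / cM qR εR) ≤ (n : ℝ) :=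
    le_trans (le_trans (le_max_right _ _) (le_max_right _ _)) hnT
  -- the parameters
  set μ : ℕ := (n - 366) / 432 with hμ
  set m : ℕ := 2 * μ + 1 with hm
  have hdiv : n - 366 < 432 * (μ + 1) := by
    have := Nat.lt_div_mul_add (a := n - 366) (b := 432) (by norm_num)
    rw [hμ]; linarith
  have hle : 432 * μ ≤ n - 366 := by rw [hμ]; exact Nat.mul_div_le _ _ |>.trans' (by rw [Nat.mul_comm])
  have hmn : n ≤ 798 * m := by omega
  have hmR : (n : ℝ) ≤ 798 * (m : ℝ) := by exact_mod_cast hmn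
  have h798 : (0 : ℝ) < 798 := by norm_num
  -- the largeness hypotheses
  have hA1 : (64 / cU εR) ^ 2 ≤ (m : ℝ) := le_of_mul_le_mul_left (hT1.trans hmR) h798
  have hA2 : 32 / cU εR ≤ (m : ℝ) := le_of_mul_le_mul_left (hT2.trans hmR) h798
  have hA3 : 16 * FQ * Real.log QB / cM qR εR ≤ (m : ℝ) := le_of_mul_le_mul_left (hT3.trans hmR) h798
  have hm1 : (m : ℝ) ≤ (m : ℝ) + 1 := by linarith
  -- the slot size
  set N : ℕ := Fintype.card (Slot m qR) with hNdef
  have hN' : N = 432 * μ + 366 := by rw [hNdef, Slot.card, hm]; unfold qR; ring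
  have hNn : N ≤ n := by omega
  have hevenN : Even N := ⟨216 * μ + 183, by rw [hN']; ring⟩
  have hevenD : Even (n - N) := (Nat.even_sub hNn).2 ⟨fun _ => hevenN, fun _ => heven⟩
  -- the factorization on the face `P_PM(N)`
  obtain ⟨A, B, hA, hB, hslack⟩ :=
    hasBlockPsdFactorization_restrict hNn (show HasBlockPsdFactorization n b r from hfac) hevenD
  have ht : Odd (tCut qR μ) := by
    unfold tCut qR
    exact Even.add_odd (Even.mul_left (by decide) _) (by decide)
  have key := block_core μ hm (hA1.trans hm1) (hA2.trans hm1) hA3 hb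
    (fun a i => B a.1 i) (fun c i => A c.1 i)
    (fun a i => hB _ i (by rw [a.2]; exact ht)) (fun c i => hA _ i c.2)
    (fun a c => by
      have h1 := hslack a.1 c.1 (by rw [a.2]; exact ht) c.2
      unfold pmSlack at h1
      rw [h1]
      exact sum_congr rfl fun i _ => Matrix.trace_mul_comm _ _)
  -- sizes: `t - 1 ≤ n`, `n ≤ 798 m`
  have htn : (tCut qR μ : ℝ) - 1 ≤ n := by
    have : tCut qR μ ≤ n := by unfold tCut qR; omega
    have : (tCut qR μ : ℝ) ≤ n := by exact_mod_cast this
    linarith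
  have ht0 : (0 : ℝ) ≤ (tCut qR μ : ℝ) - 1 := by
    have : (1 : ℝ) ≤ tCut qR μ := by exact_mod_cast ht.pos
    linarith
  have hb1 : (0 : ℝ) < (b : ℝ) + 1 := by positivity
  have hexp : δR * n / (798 * (b + 1)) ≤ δR * m / (b + 1) := by
    rw [div_le_div_iff₀ (by positivity) hb1]
    have h1 : δR * n ≤ δR * (798 * m) := mul_le_mul_of_nonneg_left hmR hδ.le
    calc δR * n * ((b : ℝ) + 1) ≤ δR * (798 * m) * ((b : ℝ) + 1) := mul_le_mul_of_nonneg_right h1 hb1.le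
      _ = δR * m * (798 * ((b : ℝ) + 1)) := by ring
  calc (2 : ℝ) ^ (δR * n / (798 * (b + 1))) ≤ (2 : ℝ) ^ (δR * m / (b + 1)) :=
        Real.rpow_le_rpow_of_exponent_le (by norm_num) hexp
    _ ≤ r * (14400 * (b : ℝ) ^ 5 * ((tCut qR μ : ℝ) - 1) ^ 3) := key
    _ ≤ r * (14400 * (b : ℝ) ^ 5 * (n : ℝ) ^ 3) :=
        mul_le_mul_of_nonneg_left (mul_le_mul_of_nonneg_left (pow_le_pow_left₀ ht0 htn 3)
          (by positivity)) (Nat.cast_nonneg r)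

/-- **Large blocks.** There are `c > 0` (`c = δ_R/798`) and `n₀` such that for all even `n ≥ n₀`, every
block size `1 ≤ b ≤ n` and every `m`: an `(S^b_+)^m` factorization of the odd-cut slack matrix of `P_PM(n)` has
`2^{c·n/(b+1)} ≤ m · n⁹`. Consequently an SDP lift of the perfect matching polytope with polynomially many
blocks must contain a block of dimension `Ω(n / log n)`, and a lift all of whose blocks have dimension
`≤ n^{1−ε}` has `2^{Ω(n^ε)}` blocks. (For `b > n` the inequality is void of content and not claimed.) -/
theorem blockPsd_largeBlocks : ∃ c : ℝ, 0 < c ∧ ∃ n₀ : ℕ, ∀ n : ℕ, n₀ ≤ n → Even n → ∀ b m : ℕ,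
    1 ≤ b → b ≤ n → HasBlockPsdFactorization n b m →
      (2 : ℝ) ^ (c * n / (b + 1)) ≤ m * (n : ℝ) ^ 9 := by
  obtain ⟨n₀, hn₀⟩ := blockPsd_explicit
  have hδ := δR_pos
  refine ⟨δR / 798, by positivity, max n₀ 14400, fun n hn heven b m hb hbn hfac => ?_⟩
  have h1 := hn₀ n (le_trans (le_max_left _ _) hn) heven b m hb hfac
  have hexp : δR * n / (798 * (b + 1)) = δR / 798 * n / ((b : ℝ) + 1) := by
    field_simp
  rw [hexp] at h1
  have hn14400 : (14400 : ℝ) ≤ n := by exact_mod_cast le_trans (le_max_right _ _) hn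
  have hbn' : (b : ℝ) ≤ n := by exact_mod_cast hbn
  have hb0 : (0 : ℝ) ≤ b := Nat.cast_nonneg b
  have hn0 : (0 : ℝ) ≤ n := Nat.cast_nonneg n
  have h2 : 14400 * (b : ℝ) ^ 5 * (n : ℝ) ^ 3 ≤ (n : ℝ) ^ 9 := by
    have e1 : (b : ℝ) ^ 5 ≤ (n : ℝ) ^ 5 := pow_le_pow_left₀ hb0 hbn' 5
    calc 14400 * (b : ℝ) ^ 5 * (n : ℝ) ^ 3 ≤ n * (n : ℝ) ^ 5 * (n : ℝ) ^ 3 := by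
          apply mul_le_mul_of_nonneg_right _ (by positivity)
          exact mul_le_mul hn14400 e1 (by positivity) hn0
      _ = (n : ℝ) ^ 9 := by ring
  exact h1.trans (mul_le_mul_of_nonneg_left h2 (Nat.cast_nonneg m))

end Summit.PneNP.PneNP.Theorems.SmallBlockRothvossBallGrid

end
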